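import Literature.NumberTheory.Automorphic.RelNormOneTorusArch
import Literature.NumberTheory.Automorphic.IdeleClassGroupUnitMaps
import Literature.Topology.Algebra.UnitsNonarchimedean
import HarnessLib

/-!
# The archimedean component of the norm-one torus and its level subgroups

Topic `NumberTheory/Automorphic`; namespace `Literature.NumberTheory.Automorphic`.

For a finite extension of number fields `L/K` and the relative norm-one torus `U(1)_{L/K}(𝔸_K) = relNormOneIdeles K L`
(file `RelNormOneTorus`) with archimedean part `U(1)(K ⊗ ℝ) = relNormOneInfUnits K L` (file `RelNormOneTorusArch`):

* § 1 the archimedean component `u ↦ u_∞ : 𝔸_Lˣ →* L_∞ˣ` (`ideleInfPart`, via the tree's `ideleGroupSplitMulEquiv`)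
  is `Aut(L/K)`-equivariant, hence maps `ker N_{L/K}` to `ker N_∞` (`relNormOneInfPart`, a continuous retraction of
  `relNormOneInfToIdeles`); an archimedean torus element `(y, 1)` is a principal idele only if `y = 1`
  (`relNormOneInfToIdeles_mem_relNormOneRat_iff`).
* § 2 levels: `L_∞ˣ · K' ≤ 𝔸_Lˣ` (`infLevelSubgroup`) is open when `K' ≤ (∏_v 𝒪_v)ˣ` is
  (tree `isOpenMap_infUnits_mul_intUnits_idele`); the level subgroup `U(1)(𝔸_K) ∩ (L_∞ˣ · K')` (`relNormOneLevel`);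
  and **for a relative torus with COMPACT archimedean part there is an open `K'` such that the only rational point of
  `U(1)(𝔸_K) ∩ (L_∞ˣ · K')` is `1`** (`exists_level_forall_mem_relNormOneRat_eq_one`: discreteness of `U(1)(K)` +
  compactness of `U(1)(K ⊗ ℝ)` + the tube lemma `compact_open_separated_mul_right` + `(∏_v 𝒪_v)ˣ` nonarchimedean,
  tree `UnitsNonarchimedean`).  This is the torus case of the finiteness of `T(K) ∩ (T_∞ × K_f)` for anisotropic
  tori [cite: PlatonovRapinchuk1994, §6.2]; it is what makes EVERY archimedean type admissible for automorphic
  characters of `[U(1)]` (file `UnitaryLineCharacters`).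

Everything is proved (Mathlib + tree); no named facts.  Port to the tree idele library of the HodgeCM publication
cell's `PerL34/UnitaryLineChars` §§ 1–2 (2026-08-18).

References: J. W. S. Cassels, A. Fröhlich (eds.), *Algebraic Number Theory* (1967), Ch. II § 16
[cite: CasselsFrohlichANT1967, Ch. II §16]; V. Platonov, A. Rapinchuk, *Algebraic Groups and Number Theory* (1994),
§ 6.2 [cite: PlatonovRapinchuk1994, §6.2].
-/

set_option autoImplicit false

noncomputable section

open _root_.Topology _root_.Set _root_.Function _root_.Filter
open scoped Pointwise
open NumberField IsDedekindDomain InfinitePlace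

namespace Literature.NumberTheory.Automorphic

/-! ## § 1. The archimedean component of an idele and of a norm-one idele -/

section InfPart

variable (L : Type) [Field L] [NumberField L]

/-- The archimedean component `u ↦ u_∞ : 𝔸_Lˣ →* L_∞ˣ`. [folklore] -/
def ideleInfPart : GaloisRepresentations.ideleGroup L →* (InfiniteAdeleRing L)ˣ :=
  (MonoidHom.fst _ _).comp (ideleGroupSplitMulEquiv L).toMonoidHom

/-- Values of the archimedean component (definitional). [folklore] -/
@[simp] theorem coe_ideleInfPart (u : GaloisRepresentations.ideleGroup L) :
    ((ideleInfPart L u : (InfiniteAdeleRing L)ˣ) : InfiniteAdeleRing L) = (u : AdeleRing (𝓞 L) L).1 := rfl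

/-- The archimedean component is continuous. [folklore] -/
theorem continuous_ideleInfPart : Continuous (ideleInfPart L) := by
  change Continuous fun u => (ideleGroupSplit L u).1
  exact (ideleGroupSplit L).continuous.fst

/-- `(y, 1)_∞ = y`. [folklore] -/
@[simp] theorem ideleInfPart_infiniteIdeles (y : (InfiniteAdeleRing L)ˣ) :
    ideleInfPart L (GaloisRepresentations.infiniteIdeles L y) = y :=
  Units.ext rfl

/-- `(1, k)_∞ = 1`. [folklore] -/
@[simp] theorem ideleInfPart_intUnitsToIdele (k : (integralAdeles L)ˣ) :
    ideleInfPart L (intUnitsToIdele L k) = 1 := by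
  change ((ideleGroupSplitMulEquiv L) ((ideleGroupSplitMulEquiv L).symm
    (1, Units.map (integralAdeles.structureRingHom L : integralAdeles L →* FiniteAdeleRing (𝓞 L) L) k))).1 = 1
  rw [MulEquiv.apply_symm_apply]

variable (K : Type) [Field K] [Algebra K L]

/-- The archimedean component is `Aut(L/K)`-equivariant. [folklore] -/
theorem ideleInfPart_smul (σ : L ≃ₐ[K] L) (u : GaloisRepresentations.ideleGroup L) :
    ideleInfPart L (σ • u) = σ • ideleInfPart L u :=
  Units.ext rfl

variable [FiniteDimensional K L]

/-- `(N_{L/K} u)_∞ = N_∞ (u_∞)`: the archimedean component intertwines the idelic and the archimedean Galois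
norms. [folklore] -/
theorem ideleInfPart_ideleGalNorm (u : GaloisRepresentations.ideleGroup L) :
    ideleInfPart L (AdeleRing.ideleGalNorm K L u) = infIdeleGalNorm K L (ideleInfPart L u) := by
  rw [AdeleRing.ideleGalNorm_apply, infIdeleGalNorm_apply, map_prod]
  exact Finset.prod_congr rfl fun σ _ => ideleInfPart_smul L K σ u

/-- The archimedean component of a norm-one idele lies in the archimedean torus `U(1)_{L/K}(K ⊗ ℝ)`.
[folklore] -/
theorem ideleInfPart_mem_relNormOneInfUnits {u : GaloisRepresentations.ideleGroup L}
    (hu : u ∈ relNormOneIdeles K L) : ideleInfPart L u ∈ relNormOneInfUnits K L := by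
  rw [mem_relNormOneInfUnits_iff, ← ideleInfPart_ideleGalNorm, (mem_relNormOneIdeles_iff K L u).mp hu, map_one]

/-- **`u ↦ u_∞ : U(1)(𝔸_K) →* U(1)(K ⊗ ℝ)`**, the archimedean component of the relative norm-one torus.
[folklore] -/
def relNormOneInfPart : relNormOneIdeles K L →* relNormOneInfUnits K L :=
  ((ideleInfPart L).comp (relNormOneIdeles K L).subtype).codRestrict (relNormOneInfUnits K L)
    fun u => ideleInfPart_mem_relNormOneInfUnits L K u.2

/-- Values of `relNormOneInfPart` (definitional). [folklore] -/
@[simp] theorem coe_relNormOneInfPart (u : relNormOneIdeles K L) :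
    ((relNormOneInfPart L K u : relNormOneInfUnits K L) : (InfiniteAdeleRing L)ˣ) = ideleInfPart L u := rfl

/-- `relNormOneInfPart` is continuous. [folklore] -/
theorem continuous_relNormOneInfPart : Continuous (relNormOneInfPart L K) :=
  ((continuous_ideleInfPart L).comp continuous_subtype_val).subtype_mk _

/-- `relNormOneInfPart` is a retraction of the archimedean embedding `y ↦ (y, 1)`. [folklore] -/
@[simp] theorem relNormOneInfPart_relNormOneInfToIdeles (y : relNormOneInfUnits K L) :
    relNormOneInfPart L K (relNormOneInfToIdeles K L y) = y :=
  Subtype.ext (by rw [coe_relNormOneInfPart, coe_relNormOneInfToIdeles, ideleInfPart_infiniteIdeles])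

/-- A rational point with trivial finite component is `1`: an archimedean torus element `(y, 1)` is a principal
idele only if `y = 1`. [folklore] -/
theorem relNormOneInfToIdeles_mem_relNormOneRat_iff (y : relNormOneInfUnits K L) :
    relNormOneInfToIdeles K L y ∈ relNormOneRat K L ↔ y = 1 := by
  constructor
  · intro hy
    rw [mem_relNormOneRat_iff, coe_relNormOneInfToIdeles] at hy
    obtain ⟨x, hx⟩ := MonoidHom.mem_range.mp hy
    -- compare finite components: `(x)_f = 1` in `𝔸_{L,f}`, hence at one finite place, hence `x = 1`
    have h2 : (algebraMap L (AdeleRing (𝓞 L) L) (x : L)).2 = (algebraMap L (AdeleRing (𝓞 L) L) 1).2 := by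
      have h := congrArg (fun u : GaloisRepresentations.ideleGroup L => ((u : AdeleRing (𝓞 L) L)).2) hx
      simp only [Units.coe_map, MonoidHom.coe_coe, coe_infiniteIdeles_eq] at h
      rw [h, map_one]
      rfl
    obtain ⟨I, hI⟩ := Ideal.exists_maximal (𝓞 L)
    let v : HeightOneSpectrum (𝓞 L) :=
      ⟨I, hI.isPrime, Ring.ne_bot_of_isMaximal_of_not_isField hI (RingOfIntegers.not_isField L)⟩
    have hv :=
      congrFun (congrArg (fun z : FiniteAdeleRing (𝓞 L) L => (z : ∀ w : HeightOneSpectrum (𝓞 L), _)) h2) v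
    simp only [AdeleRing.algebraMap_snd_apply] at hv
    have hx1 : (x : L) = 1 := (algebraMap L (v.adicCompletion L)).injective hv
    have hx1' : x = 1 := Units.ext hx1
    rw [hx1', map_one] at hx
    have hy1 : (y : (InfiniteAdeleRing L)ˣ) = 1 :=
      infiniteIdeles_injective (L := L) (by rw [map_one]; exact hx.symm)
    exact Subtype.ext hy1
  · rintro rfl
    rw [map_one]
    exact one_mem _

end InfPart

/-! ## § 2. Levels: `U(1)(K) ∩ (U(1)(K ⊗ ℝ) × K')` is trivial once `K'` is small -/

section Level

variable (L : Type) [Field L] [NumberField L]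

/-- `(x, k) ↦ (x, 1)·(1, k) : L_∞ˣ × (∏_v 𝒪_v)ˣ →* 𝔸_Lˣ` (the tree's open embedding, as a homomorphism).
[folklore] -/
def infIntUnitsToIdele : (InfiniteAdeleRing L)ˣ × (integralAdeles L)ˣ →* GaloisRepresentations.ideleGroup L :=
  (GaloisRepresentations.infiniteIdeles L).coprod (intUnitsToIdele L)

/-- Values of `infIntUnitsToIdele` (definitional). [folklore] -/
theorem infIntUnitsToIdele_apply (p : (InfiniteAdeleRing L)ˣ × (integralAdeles L)ˣ) :
    infIntUnitsToIdele L p = GaloisRepresentations.infiniteIdeles L p.1 * intUnitsToIdele L p.2 := rfl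

/-- `infIntUnitsToIdele` is an open map. [cite: CasselsFrohlichANT1967, Ch. II §16] -/
theorem isOpenMap_infIntUnitsToIdele : IsOpenMap (infIntUnitsToIdele L) :=
  isOpenMap_infUnits_mul_intUnits_idele L

/-- **`L_∞ˣ · K' ≤ 𝔸_Lˣ`** for a subgroup `K' ≤ (∏_v 𝒪_v)ˣ` of the integral ideles. [folklore] -/
def infLevelSubgroup (K' : Subgroup (integralAdeles L)ˣ) : Subgroup (GaloisRepresentations.ideleGroup L) :=
  ((⊤ : Subgroup (InfiniteAdeleRing L)ˣ).prod K').map (infIntUnitsToIdele L)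

/-- Membership in `L_∞ˣ · K'`. [folklore] -/
theorem mem_infLevelSubgroup_iff (K' : Subgroup (integralAdeles L)ˣ) (u : GaloisRepresentations.ideleGroup L) :
    u ∈ infLevelSubgroup L K' ↔
      ∃ (x : (InfiniteAdeleRing L)ˣ) (k : (integralAdeles L)ˣ), k ∈ K' ∧
        u = GaloisRepresentations.infiniteIdeles L x * intUnitsToIdele L k := by
  constructor
  · rintro ⟨p, hp, rfl⟩
    exact ⟨p.1, p.2, (Subgroup.mem_prod.mp hp).2, rfl⟩
  · rintro ⟨x, k, hk, rfl⟩
    exact ⟨(x, k), Subgroup.mem_prod.mpr ⟨Subgroup.mem_top x, hk⟩, rfl⟩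

/-- `(x, 1) ∈ L_∞ˣ · K'`. [folklore] -/
theorem infiniteIdeles_mem_infLevelSubgroup (K' : Subgroup (integralAdeles L)ˣ) (x : (InfiniteAdeleRing L)ˣ) :
    GaloisRepresentations.infiniteIdeles L x ∈ infLevelSubgroup L K' :=
  (mem_infLevelSubgroup_iff L K' _).mpr ⟨x, 1, one_mem K', by rw [map_one, mul_one]⟩

/-- `L_∞ˣ · K'` is open in `𝔸_Lˣ` when `K'` is open in `(∏_v 𝒪_v)ˣ`. [cite: CasselsFrohlichANT1967, Ch. II §16] -/
theorem isOpen_infLevelSubgroup (K' : OpenSubgroup (integralAdeles L)ˣ) :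
    IsOpen (infLevelSubgroup L (K' : Subgroup (integralAdeles L)ˣ) : Set (GaloisRepresentations.ideleGroup L)) := by
  rw [infLevelSubgroup, Subgroup.coe_map, Subgroup.coe_prod]
  exact isOpenMap_infIntUnitsToIdele L _ (isOpen_univ.prod K'.isOpen)

variable (K : Type) [Field K] [Algebra K L] [FiniteDimensional K L]

/-- **`U(1)(𝔸_K) ∩ (L_∞ˣ · K')`**, the level-`K'` subgroup of the norm-one torus. [folklore] -/
def relNormOneLevel (K' : Subgroup (integralAdeles L)ˣ) : Subgroup (relNormOneIdeles K L) :=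
  (infLevelSubgroup L K').comap (relNormOneIdeles K L).subtype

/-- Membership in the level subgroup (definitional). [folklore] -/
theorem mem_relNormOneLevel_iff (K' : Subgroup (integralAdeles L)ˣ) (u : relNormOneIdeles K L) :
    u ∈ relNormOneLevel L K K' ↔ (u : GaloisRepresentations.ideleGroup L) ∈ infLevelSubgroup L K' := Iff.rfl

/-- The level subgroup is open when `K'` is. [folklore] -/
theorem isOpen_relNormOneLevel (K' : OpenSubgroup (integralAdeles L)ˣ) :
    IsOpen (relNormOneLevel L K (K' : Subgroup (integralAdeles L)ˣ) : Set (relNormOneIdeles K L)) := by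
  rw [relNormOneLevel, Subgroup.coe_comap]
  exact (isOpen_infLevelSubgroup L K').preimage continuous_subtype_val

/-- The archimedean torus lies in every level subgroup. [folklore] -/
theorem relNormOneInfToIdeles_mem_relNormOneLevel (K' : Subgroup (integralAdeles L)ˣ) (y : relNormOneInfUnits K L) :
    relNormOneInfToIdeles K L y ∈ relNormOneLevel L K K' :=
  infiniteIdeles_mem_infLevelSubgroup L K' _

/-- Decomposition of a level-`K'` norm-one idele: `u = (u_∞, 1) · (1, k)` with `u_∞` in the archimedean torus and
`k ∈ K'`. [folklore] -/
theorem exists_eq_mul_of_mem_relNormOneLevel {K' : Subgroup (integralAdeles L)ˣ} {u : relNormOneIdeles K L}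
    (hu : u ∈ relNormOneLevel L K K') :
    ∃ k : (integralAdeles L)ˣ, k ∈ K' ∧
      (u : GaloisRepresentations.ideleGroup L) =
        GaloisRepresentations.infiniteIdeles L (relNormOneInfPart L K u : (InfiniteAdeleRing L)ˣ) *
          intUnitsToIdele L k := by
  obtain ⟨x, k, hk, hxk⟩ :=
    (mem_infLevelSubgroup_iff L K' (u : GaloisRepresentations.ideleGroup L)).mp
      ((mem_relNormOneLevel_iff L K K' u).mp hu)
  refine ⟨k, hk, ?_⟩
  have hx : (relNormOneInfPart L K u : (InfiniteAdeleRing L)ˣ) = x := by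
    rw [coe_relNormOneInfPart, hxk, map_mul, ideleInfPart_infiniteIdeles, ideleInfPart_intUnitsToIdele, mul_one]
  rw [hx]
  exact hxk

/-- **`U(1)(K) ∩ (U(1)(K ⊗ ℝ) × K') = 1` once `K'` is small.**  For a relative norm-one torus whose archimedean
part is compact there is an open subgroup `K'` of the integral ideles such that the only rational point of the
level-`K'` subgroup `U(1)(𝔸_K) ∩ (L_∞ˣ · K')` is `1` (discreteness of `U(1)(K)`, compactness of `U(1)(K ⊗ ℝ)`, the
tube lemma, and `(∏_v 𝒪_v)ˣ` nonarchimedean). [cite: PlatonovRapinchuk1994, §6.2] -/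
theorem exists_level_forall_mem_relNormOneRat_eq_one [CompactSpace (relNormOneInfUnits K L)] :
    ∃ K' : OpenSubgroup (integralAdeles L)ˣ,
      ∀ u : relNormOneIdeles K L, u ∈ relNormOneLevel L K (K' : Subgroup (integralAdeles L)ˣ) →
        u ∈ relNormOneRat K L → u = 1 := by
  classical
  -- the compact set `C = U(1)(K ⊗ ℝ) × {1}`
  have hC : IsCompact (Set.range (relNormOneInfToIdeles K L)) :=
    isCompact_range (continuous_relNormOneInfToIdeles K L)
  -- the closed set `Γ' = U(1)(K) ∖ {1}` (a subset of a discrete closed subgroup)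
  have hΓ' : IsClosed ((relNormOneRat K L : Set (relNormOneIdeles K L)) \ {1}) := by
    have hce : IsClosedEmbedding (Subtype.val : relNormOneRat K L → relNormOneIdeles K L) :=
      (isClosed_relNormOneRat K L).isClosedEmbedding_subtypeVal
    have heq : (relNormOneRat K L : Set (relNormOneIdeles K L)) \ {1} =
        Subtype.val '' {γ : relNormOneRat K L | γ ≠ 1} := by
      ext a
      constructor
      · rintro ⟨ha, hne⟩
        exact ⟨⟨a, ha⟩, fun h => hne (congrArg Subtype.val h), rfl⟩
      · rintro ⟨γ, hγ, rfl⟩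
        exact ⟨γ.2, fun h => hγ (Subtype.ext h)⟩
    rw [heq]
    exact hce.isClosedMap _ (isClosed_discrete _)
  -- `C` misses `Γ'`
  have hCΓ : Set.range (relNormOneInfToIdeles K L) ⊆
      ((relNormOneRat K L : Set (relNormOneIdeles K L)) \ {1})ᶜ := by
    rintro _ ⟨y, rfl⟩ ⟨hmem, hne⟩
    exact hne (by
      rw [Set.mem_singleton_iff, (relNormOneInfToIdeles_mem_relNormOneRat_iff L K y).mp hmem, map_one])
  -- tube lemma: an identity neighbourhood `V` with `C · V` still missing `Γ'`
  obtain ⟨V, hV, hCV⟩ := compact_open_separated_mul_right hC hΓ'.isOpen_compl hCΓ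
  -- `V ⊇ U(1)(𝔸) ∩ W` for an identity neighbourhood `W` of the ideles
  obtain ⟨W, hW, hWV⟩ : ∃ W ∈ 𝓝 (1 : GaloisRepresentations.ideleGroup L), Subtype.val ⁻¹' W ⊆ V :=
    (mem_nhds_subtype _ _ _).mp hV
  -- `W ⊇ {1} × K'` for an open subgroup `K'` of the (nonarchimedean) integral ideles
  have hW1 : intUnitsToIdele L ⁻¹' W ∈ 𝓝 (1 : (integralAdeles L)ˣ) :=
    (continuous_intUnitsToIdele L).continuousAt.preimage_mem_nhds (by rwa [map_one])
  obtain ⟨K', hK'W⟩ := NonarchimedeanGroup.is_nonarchimedean _ hW1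
  refine ⟨K', fun u hu hΓu => ?_⟩
  -- `u = c · v` with `c ∈ C`, `v = (1, k) ∈ V`
  obtain ⟨k, hk, huk⟩ := exists_eq_mul_of_mem_relNormOneLevel L K hu
  set c : relNormOneIdeles K L := relNormOneInfToIdeles K L (relNormOneInfPart L K u) with hc
  have hv : c⁻¹ * u ∈ V := by
    apply hWV
    show ((c⁻¹ * u : relNormOneIdeles K L) : GaloisRepresentations.ideleGroup L) ∈ W
    rw [Subgroup.coe_mul, Subgroup.coe_inv, hc, coe_relNormOneInfToIdeles, huk, inv_mul_cancel_left]
    exact hK'W hk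
  have hu' : u ∈ Set.range (relNormOneInfToIdeles K L) * V :=
    Set.mem_mul.mpr ⟨c, ⟨_, rfl⟩, c⁻¹ * u, hv, mul_inv_cancel_left c u⟩
  by_contra hne
  exact hCV hu' ⟨hΓu, hne⟩

end Level

end Literature.NumberTheory.Automorphic

end
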